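import Summits.Ventures.DiscreteObjects.Hadamard.Order83InvertingInvolution668

/-!
# H(668): involutions INVERTING an element of odd prime order `p` — the uniform count, and the windows at 37 and 41
# (kernel; uniform version of `Order83InvertingInvolution668`)

Framing: lottery ticket; floor = certified bounds/negative ranges.

Cell pub-namedobj (venture DiscreteObjects), target (H), hadamard gen 22.  For a permutation `π` of prime exponent `p` (odd)
and a permutation `ψ` INVERTING it (`ψπ = π^μ ψ`, `μ ≡ −1 (mod p)`): `ψ` maps `Fix π` onto itself
(`fixed_stable_of_normalizing_prime`, any multiplier prime to `p`), acts on every preserved `π`-orbit as `s ↦ −s + c` and so has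
AT MOST ONE fixed point per orbit (`inverting_fixed_orbit_unique_prime`: `μk ≡ k` forces `2k ≡ 0`, `k = 0`); hence for an
involution `ψ`: `#Fix ψ = f₀ + m` with `f₀ + 2j = #Fix π` (an involution on `Fix π`) and `m ≤ #classes(π)`
(`inverting_involution_count_prime`), and `m = #classes` forces every orbit to be preserved (`rows_preserved_of_card_fixed_moved_prime`).
With the H(668) census values (gen 5–9: `σ₃₇`: `2 + 2` fixed, `18 + 18` orbits; `σ₄₁`: `12 + 12` fixed, `16 + 16` orbits) and the
involution census (gen 13: `f ≡ 4 (mod 8)`, `4 ≤ f ≤ 332`, or `f = 0`):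
* **`hadamard668_order37_inverting_involution`**: an involution inverting an element of order `37` fixes **`0, 4, 12` or `20`**
  rows (as many columns); `20` forces all `18` row orbits and all `18` column orbits preserved and the `2 + 2` fixed points fixed.
* **`hadamard668_order41_inverting_involution`**: an involution inverting an element of order `41` fixes **`0, 4, 12, 20` or
  `28`** rows (as many columns); `28` forces all `16 + 16` orbits preserved and the `12 + 12` fixed points fixed.
(Order `83`: `0, 4, 12`, gen 22; order `167`: `0` or `4`, gen 21.)  WINDOWS / STRUCTURE of a hypothetical object; no automorphism
order and no Hadamard order is excluded; H(668) untouched; HITS 0/4.  Ours; no `sorry`, no definitions, default heartbeats.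
-/

namespace Summit.Ventures.DiscreteObjects.Hadamard

open Finset BigOperators Matrix

open Literature.Combinatorics.Designs.GoethalsSeidel (IsHadamardMatrix)

variable {ι : Type*} [Fintype ι] [DecidableEq ι]

/-! ### uniform tools: a permutation inverting a permutation of odd prime exponent -/

section permp
variable {π ψ : Equiv.Perm ι} {p μ : ℕ} (hp : p.Prime) (hn : ψ * π = π ^ μ * ψ) (hπ : π ^ p = 1)
include hp hn hπ

omit [Fintype ι] [DecidableEq ι] in
/-- a permutation normalising `π` (prime exponent `p`, multiplier prime to `p`) maps `Fix π` onto itself -/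
lemma fixed_stable_of_normalizing_prime (hcop : μ % p ≠ 0) : ∀ x, π (ψ x) = ψ x ↔ π x = x := by
  intro x
  constructor
  · intro h
    have h1 : ψ (π x) = ψ x := by
      rw [norm_apply hn x, perm_pow_apply_of_fixed π h μ]
    exact ψ.injective h1
  · intro h
    have h1 : (π ^ μ) (ψ x) = ψ x := by rw [← norm_apply hn x, h]
    have hnd : ¬ p ∣ μ := fun h0 => hcop (Nat.mod_eq_zero_of_dvd h0)
    obtain ⟨m, -, hm⟩ := Nat.exists_mul_mod_eq_one_of_coprime ((Nat.Prime.coprime_iff_not_dvd hp).mpr hnd).symm hp.one_lt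
    have h2 : (π ^ (μ * m)) (ψ x) = ψ x := by rw [pow_mul]; exact perm_pow_apply_of_fixed _ h1 m
    rw [← pow_mod_of_pow_eq_one π hπ (μ * m), hm, pow_one] at h2
    exact h2

variable (hodd : p ≠ 2) (hμ : μ % p = p - 1)
include hodd hμ

omit [Fintype ι] in
/-- two `ψ`-fixed points in one `π`-orbit of length `p` coincide (`ψ` is `s ↦ −s + c` on the orbit and `2` is invertible mod `p`) -/
lemma inverting_fixed_orbit_unique_prime {x y : ι} (hxm : π x ≠ x) (hx : ψ x = x) (hy : ψ y = y)
    (hmem : y ∈ orbFin π p x) : y = x := by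
  haveI : NeZero p := ⟨hp.ne_zero⟩
  haveI : Fact p.Prime := ⟨hp⟩
  obtain ⟨k, hk, rfl⟩ := Finset.mem_image.mp hmem
  rw [Finset.mem_range] at hk
  rw [norm_apply_pow hn k x, hx, ← pow_mod_of_pow_eq_one π hπ (μ * k)] at hy
  have hk' : (μ * k) % p = k := perm_pow_apply_injective π hp hπ hxm (Nat.mod_lt _ hp.pos) hk hy
  -- in ZMod p: μ k = k with μ = -1, so 2k = 0, so k = 0
  have hμ' : (μ : ZMod p) = -1 := by
    rw [← ZMod.natCast_mod μ p, hμ, Nat.cast_sub hp.one_lt.le, ZMod.natCast_self, Nat.cast_one, zero_sub]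
  have h1 : ((μ * k : ℕ) : ZMod p) = (k : ZMod p) := by rw [← ZMod.natCast_mod (μ * k) p, hk']
  push_cast at h1
  rw [hμ'] at h1
  have h2 : (2 : ZMod p) * (k : ZMod p) = 0 := by linear_combination (-1 : ZMod p) * h1
  have h2ne : (2 : ZMod p) ≠ 0 := by
    rw [show (2 : ZMod p) = ((2 : ℕ) : ZMod p) by norm_num, Ne, ZMod.natCast_eq_zero_iff]
    intro hdvd
    exact hodd ((Nat.prime_dvd_prime_iff_eq hp Nat.prime_two).mp hdvd)
  have hk0' : (k : ZMod p) = 0 := by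
    rcases mul_eq_zero.mp h2 with h | h
    · exact absurd h h2ne
    · exact h
  rw [ZMod.natCast_eq_zero_iff] at hk0'
  have hk0 : k = 0 := Nat.eq_zero_of_dvd_of_lt hk0' hk
  rw [hk0, pow_zero, Equiv.Perm.one_apply]

/-- hence `#{x : ψ x = x, π x ≠ x} ≤ #classes of π` -/
lemma card_fixed_moved_le_classes_of_inverting_prime :
    (univ.filter fun x => ψ x = x ∧ π x ≠ x).card ≤ (blockClasses π p).card := by
  refine Finset.card_le_card_of_injOn (fun x => orbFin π p x) ?_ ?_
  · intro x hx
    have hx' := (Finset.mem_filter.mp (Finset.mem_coe.mp hx)).2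
    exact Finset.mem_coe.mpr (Finset.mem_image_of_mem _ (Finset.mem_filter.mpr ⟨Finset.mem_univ _, hx'.2⟩))
  · intro x hx y hy hxy
    have hx' := (Finset.mem_filter.mp (Finset.mem_coe.mp hx)).2
    have hy' := (Finset.mem_filter.mp (Finset.mem_coe.mp hy)).2
    have hmem : y ∈ orbFin π p x := by
      have e : orbFin π p x = orbFin π p y := hxy
      rw [e]; exact mem_orbFin_self π hp.pos y
    exact (inverting_fixed_orbit_unique_prime hp hn hπ hodd hμ hx'.2 hx'.1 hy'.1 hmem).symm

/-- if `ψ` fixes a point in as many orbits as `π` has classes, every orbit is preserved -/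
lemma rows_preserved_of_card_fixed_moved_prime
    (hcard : (univ.filter fun x => ψ x = x ∧ π x ≠ x).card = (blockClasses π p).card) :
    ∀ x, π x ≠ x → ψ x ∈ orbFin π p x := by
  have hinj : Set.InjOn (fun x => orbFin π p x) ↑(univ.filter fun x => ψ x = x ∧ π x ≠ x) := by
    intro x hx y hy hxy
    have hx' := (Finset.mem_filter.mp (Finset.mem_coe.mp hx)).2
    have hy' := (Finset.mem_filter.mp (Finset.mem_coe.mp hy)).2
    have hmem : y ∈ orbFin π p x := by
      have e : orbFin π p x = orbFin π p y := hxy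
      rw [e]; exact mem_orbFin_self π hp.pos y
    exact (inverting_fixed_orbit_unique_prime hp hn hπ hodd hμ hx'.2 hx'.1 hy'.1 hmem).symm
  have hsub : (univ.filter fun x => ψ x = x ∧ π x ≠ x).image (fun x => orbFin π p x) ⊆ blockClasses π p := by
    intro C hC
    obtain ⟨x, hx, rfl⟩ := Finset.mem_image.mp hC
    exact Finset.mem_image_of_mem _ (Finset.mem_filter.mpr ⟨Finset.mem_univ _, (Finset.mem_filter.mp hx).2.2⟩)
  have heq : (univ.filter fun x => ψ x = x ∧ π x ≠ x).image (fun x => orbFin π p x) = blockClasses π p := by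
    apply Finset.eq_of_subset_of_card_le hsub
    rw [Finset.card_image_of_injOn hinj, hcard]
  intro x hxm
  have hC : orbFin π p x ∈ (univ.filter fun x => ψ x = x ∧ π x ≠ x).image (fun x => orbFin π p x) := by
    rw [heq]; exact Finset.mem_image_of_mem _ (Finset.mem_filter.mpr ⟨Finset.mem_univ _, hxm⟩)
  obtain ⟨y, hy, hyx⟩ := Finset.mem_image.mp hC
  have hy' := (Finset.mem_filter.mp hy).2
  have hxmem : x ∈ orbFin π p y := by
    have h : x ∈ orbFin π p x := mem_orbFin_self π hp.pos x
    rwa [← hyx] at h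
  obtain ⟨k, -, rfl⟩ := Finset.mem_image.mp hxmem
  rw [norm_apply_pow hn k y, hy'.1, orbFin_eq_of_mem π hp hπ hy'.2 hxmem]
  exact pow_apply_mem_orbFin π hp.pos hπ y _

/-- **the uniform count**: for an involution `ψ` inverting `π`: `#Fix ψ = f₀ + m` with `f₀ + 2j = #Fix π`, `m ≤ #classes(π)`, and
`m = #classes(π)` only if every orbit is preserved, `f₀ = #Fix π` only if every `π`-fixed point is `ψ`-fixed -/
theorem inverting_involution_count_prime (hψ : ψ ^ 2 = 1) : ∃ f₀ m j : ℕ, f₀ + 2 * j = (univ.filter fun x => π x = x).card ∧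
    m ≤ (blockClasses π p).card ∧ (univ.filter fun x => ψ x = x).card = f₀ + m ∧
    (m = (blockClasses π p).card → ∀ x, π x ≠ x → ψ x ∈ orbFin π p x) ∧
    (f₀ = (univ.filter fun x => π x = x).card → ∀ x, π x = x → ψ x = x) := by
  have hcop : μ % p ≠ 0 := by rw [hμ]; have := hp.one_lt; omega
  have hstab := fixed_stable_of_normalizing_prime hp hn hπ hcop
  obtain ⟨j, hj⟩ := card_fixed_fixed_mod_two' hstab hψ
  refine ⟨_, _, j, hj, card_fixed_moved_le_classes_of_inverting_prime hp hn hπ hodd hμ, card_fixed_split π ψ,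
    rows_preserved_of_card_fixed_moved_prime hp hn hπ hodd hμ, fun hf₀ x hx => ?_⟩
  have hsub : (univ.filter fun x => ψ x = x ∧ π x = x) ⊆ univ.filter fun x => π x = x := by
    intro z hz; exact Finset.mem_filter.mpr ⟨Finset.mem_univ _, (Finset.mem_filter.mp hz).2.2⟩
  have heq' := Finset.eq_of_subset_of_card_le hsub (by rw [hf₀])
  have hx' : x ∈ univ.filter fun x => π x = x := Finset.mem_filter.mpr ⟨Finset.mem_univ _, hx⟩
  rw [← heq'] at hx'
  exact (Finset.mem_filter.mp hx').2.1

end permp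

/-! ### H(668): windows at 37 and 41 -/

section main
variable {H : Matrix ι ι ℤ} (hH : IsHadamardMatrix H) (hι : Fintype.card ι = 668)
  {π κ π' κ' : Equiv.Perm ι} {d e d' e' : ι → ℤ} (haut : IsSignedAut H π κ d e)
  (haut' : IsSignedAut H π' κ' d' e') {μ : ℕ} (hnπ : π' * π = π ^ μ * π') (hnκ : κ' * κ = κ ^ μ * κ')
  (h2 : π' ^ 2 = 1) (h2' : κ' ^ 2 = 1) (hne' : π' ≠ 1 ∨ κ' ≠ 1)
include hH hι haut haut' hnπ hnκ h2 h2' hne'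

/-- **Involutions inverting an element of order 37 fix `0, 4, 12` or `20` rows (as many columns); `20` forces every orbit
preserved and every `σ`-fixed point fixed.** -/
theorem hadamard668_order37_inverting_involution (hπ : π ^ 37 = 1) (hκ : κ ^ 37 = 1) (hne : π ≠ 1 ∨ κ ≠ 1)
    (hμ : μ % 37 = 36) :
    (univ.filter fun x => π' x = x).card = (univ.filter fun y => κ' y = y).card ∧
    ((univ.filter fun x => π' x = x).card = 0 ∨ (univ.filter fun x => π' x = x).card = 4 ∨
      (univ.filter fun x => π' x = x).card = 12 ∨ (univ.filter fun x => π' x = x).card = 20) ∧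
    ((univ.filter fun x => π' x = x).card = 20 →
      (∀ x, π x ≠ x → π' x ∈ orbFin π 37 x) ∧ (∀ x, π x = x → π' x = x) ∧
      (∀ y, κ y ≠ y → κ' y ∈ orbFin κ 37 y) ∧ (∀ y, κ y = y → κ' y = y)) := by
  have p37 : Nat.Prime 37 := by norm_num
  have h37 := hadamard668_fixedRows_37 hH hι π κ d e haut hπ hκ hne
  have hclπ := card_fixed_add_classes π p37 hπ
  have hclκ := card_fixed_add_classes κ p37 hκ
  rw [h37.1, hι] at hclπ
  rw [h37.2, hι] at hclκ
  have hcπ : (blockClasses π 37).card = 18 := by omega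
  have hcκ : (blockClasses κ 37).card = 18 := by omega
  obtain ⟨f₀, m, j, hj, hm, hf, hall, hfix⟩ := inverting_involution_count_prime p37 hnπ hπ (by norm_num) hμ h2
  obtain ⟨g₀, n, l, hl, hn, hg, hall', hfix'⟩ := inverting_involution_count_prime p37 hnκ hκ (by norm_num) hμ h2'
  rw [h37.1] at hj hfix
  rw [h37.2] at hl hfix'
  rw [hcπ] at hm hall
  rw [hcκ] at hn hall'
  obtain ⟨-, -, hcases⟩ := hadamard668_involution_census_final hH hι π' κ' d' e' haut' h2 h2' hne'
  rcases hcases with ⟨heq, hmod8, h4, -, -⟩ | ⟨h0, h0', -, -⟩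
  · refine ⟨heq, Or.inr (by omega), fun h20 => ?_⟩
    exact ⟨hall (by omega), hfix (by omega), hall' (by omega), hfix' (by omega)⟩
  · refine ⟨by rw [h0, h0'], Or.inl h0, fun h20 => ?_⟩
    rw [h0] at h20
    exact absurd h20 (by norm_num)

/-- **Involutions inverting an element of order 41 fix `0, 4, 12, 20` or `28` rows (as many columns); `28` forces every orbit
preserved and every `σ`-fixed point fixed.** -/
theorem hadamard668_order41_inverting_involution (hπ : π ^ 41 = 1) (hκ : κ ^ 41 = 1) (hne : π ≠ 1 ∨ κ ≠ 1)
    (hμ : μ % 41 = 40) :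
    (univ.filter fun x => π' x = x).card = (univ.filter fun y => κ' y = y).card ∧
    ((univ.filter fun x => π' x = x).card = 0 ∨ (univ.filter fun x => π' x = x).card = 4 ∨
      (univ.filter fun x => π' x = x).card = 12 ∨ (univ.filter fun x => π' x = x).card = 20 ∨
      (univ.filter fun x => π' x = x).card = 28) ∧
    ((univ.filter fun x => π' x = x).card = 28 →
      (∀ x, π x ≠ x → π' x ∈ orbFin π 41 x) ∧ (∀ x, π x = x → π' x = x) ∧
      (∀ y, κ y ≠ y → κ' y ∈ orbFin κ 41 y) ∧ (∀ y, κ y = y → κ' y = y)) := by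
  have p41 : Nat.Prime 41 := by norm_num
  have h41 := hadamard668_fixedRows_41 hH hι π κ d e haut hπ hκ hne
  have hclπ := card_fixed_add_classes π p41 hπ
  have hclκ := card_fixed_add_classes κ p41 hκ
  rw [h41.1, hι] at hclπ
  rw [h41.2, hι] at hclκ
  have hcπ : (blockClasses π 41).card = 16 := by omega
  have hcκ : (blockClasses κ 41).card = 16 := by omega
  obtain ⟨f₀, m, j, hj, hm, hf, hall, hfix⟩ := inverting_involution_count_prime p41 hnπ hπ (by norm_num) hμ h2
  obtain ⟨g₀, n, l, hl, hn, hg, hall', hfix'⟩ := inverting_involution_count_prime p41 hnκ hκ (by norm_num) hμ h2'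
  rw [h41.1] at hj hfix
  rw [h41.2] at hl hfix'
  rw [hcπ] at hm hall
  rw [hcκ] at hn hall'
  obtain ⟨-, -, hcases⟩ := hadamard668_involution_census_final hH hι π' κ' d' e' haut' h2 h2' hne'
  rcases hcases with ⟨heq, hmod8, h4, -, -⟩ | ⟨h0, h0', -, -⟩
  · refine ⟨heq, Or.inr (by omega), fun h28 => ?_⟩
    exact ⟨hall (by omega), hfix (by omega), hall' (by omega), hfix' (by omega)⟩
  · refine ⟨by rw [h0, h0'], Or.inl h0, fun h28 => ?_⟩
    rw [h0] at h28
    exact absurd h28 (by norm_num)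

end main

end Summit.Ventures.DiscreteObjects.Hadamard
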